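import Literature.NumberTheory.EllipticCurves.CuspFormAutConjProofs
import Literature.NumberTheory.EllipticCurves.DeligneSerreProp27LevelDescentProofs
import Literature.NumberTheory.GaloisRepresentations.PadicAlgClFiniteSubextensionDvr
import Literature.NumberTheory.GaloisRepresentations.TeichmullerCharacter
import Literature.RingTheory.DiscreteValuationRing.DeligneSerreEigenvectorLift
import Literature.FieldTheory.AlgClosed.PadicAlgClEquivComplex
import HarnessLib

/-!
# Deligne–Serre lifting of a mod-`𝔪` Hecke eigenvector, read through `ι : ℚ̄_p ≃ ℂ`

A proofs-only leaf (theorems only: no definition, no named fact; D-0026).  Throughout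
`ι : ℚ̄_p ≃+* ℂ` is a field isomorphism, and "integral", "`≡ (mod 𝔪)`" for complex numbers are
read in `ℚ̄_p`: `v(ι⁻¹ z) ≤ 1`, `v(ι⁻¹ z) < 1` (`v = Valued.v`, the `p`-adic valuation of
`ℚ̄_p = PadicAlgCl p`), as in `EisensteinNewformLevelRaising` and its proof files.

* `exists_eigenform_of_modP_eigenvector` — **Deligne–Serre 1974, 6.10–6.11 (Lemme 6.11) in the
  `ι`-language.**  Let `G ∈ S_k(L, χ)` (`k ≥ 1`) have `ι`-integral Fourier coefficients, one of
  which is an `ι`-unit, and let `P` be a set of primes such that `G` is an eigenvector of `T_q`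
  modulo `𝔪` for `q ∈ P` — `a_n(T_q G) ≡ λ_q a_n(G) (mod 𝔪)` for all `n` (for `q ∣ L` the operator
  `T_q` is `U_q`).  Then there is a genuine simultaneous eigenform `g ∈ S_k(L, χ)`, `g ≠ 0`,
  `T_q g = α_q g` for `q ∈ P`, with `ι`-integral eigenvalues `α_q ≡ λ_q (mod 𝔪)`.

Proof.  The tree's abstract form of 6.10–6.11
(`Literature.RingTheory.DiscreteValuationRing.DeligneSerre1974.exists_eigenvector_lift`) is applied
over the discrete valuation ring `𝒪 = 𝒪_E`, the closed unit ball of the finite extension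
`E = ℚ_p(ι⁻¹ c_i, ι⁻¹ χ(d)) ⊆ ℚ̄_p` generated by the coordinates `c_i` of `G` in Deligne–Serre's
integral basis of `S_k(Γ₁(L))` ((2.7.2), `integralBasis`, `DeligneSerre1974_span_integralLattice1_holds`)
and the values of `χ` (`PadicAlgCl.isDiscreteValuationRing_unitBall`; every `a_n(G)` then lies in
`ι(E)`), mapped into `ℂ` by `ι`; the mod-`𝔪` eigenvalue used for `T_q` is `a_{m₀}(T_q x)`,
`x = a_{m₀}(G)⁻¹ G`.  The lemma returns a discrete valuation ring `𝒪' ⊇ 𝒪` with fraction field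
`K'` finite over `E`, an embedding `e : K' → ℂ` over `𝒪` and an eigenform with eigenvalues
`e(a'_q)`, `a'_q ≡ a_q (mod 𝔪')`; since `E` is complete, `𝒪'` is the valuation ring of the unique
extension of the valuation of `E`, so these congruences are congruences in `ℚ̄_p` along
`ι⁻¹ ∘ e` (`PadicAlgCl.norm_algebraMap_le_one_of_dvr`).  This is the step "By the Deligne–Serre
lifting lemma [DeSe74, Lemme 6.11] …" of Billerey–Menares 2018, §3.2, in the form needed there
(operators `T_q`, `q ∤ NM`, and `U_M`).

## References

* P. Deligne, J.-P. Serre, *Formes modulaires de poids 1*, Ann. Sci. ÉNS (4) 7 (1974), 6.10,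
  Lemme 6.11. [DeligneSerreASENS1974]
* N. Billerey, R. Menares, *Strong modularity of reducible Galois representations*, Trans. Amer.
  Math. Soc. 370 (2018), §3.2. [BillereyMenares2018]
* J.-P. Serre, *Local Fields*, GTM 67 (1979), Ch. II §2. [SerreLocalFields1979]
-/

noncomputable section

open scoped MatrixGroups ModularForm NNReal

open CongruenceSubgroup UpperHalfPlane IsLocalRing
open Literature.NumberTheory.GaloisRepresentations

namespace Literature.NumberTheory.EllipticCurves.ModularForms

universe u

variable {p : ℕ} [Fact p.Prime]

/-! ### Valuations through `ι` -/

section Iota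

/-- `v(y) < 1 ↔ ‖y‖ < 1` on `ℚ̄_p` (companion of `PadicAlgCl.valuation_le_one_iff` of
`TeichmullerCharacter`, where it is private). [folklore] -/
private theorem PadicAlgCl.v_lt_one_iff (y : PadicAlgCl p) : Valued.v y < 1 ↔ ‖y‖ < 1 := by
  rw [PadicAlgCl.valuation_def, ← NNReal.coe_lt_coe, coe_nnnorm, NNReal.coe_one]

variable (ι : PadicAlgCl p ≃+* ℂ)

/-- Ultrametric inequality through `ι`. [folklore] -/
theorem v_symm_add_le (a b : ℂ) :
    Valued.v (ι.symm (a + b)) ≤ max (Valued.v (ι.symm a)) (Valued.v (ι.symm b)) := by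
  rw [map_add]
  exact Valuation.map_add _ _ _

/-- `v(ι⁻¹(a - b)) < 1` from `v(ι⁻¹(a - c)) < 1` and `v(ι⁻¹(c - b)) < 1`. [folklore] -/
theorem v_symm_sub_lt_one_trans {a b c : ℂ} (h₁ : Valued.v (ι.symm (a - c)) < 1)
    (h₂ : Valued.v (ι.symm (c - b)) < 1) : Valued.v (ι.symm (a - b)) < 1 := by
  have : a - b = (a - c) + (c - b) := by ring
  rw [this]
  exact (v_symm_add_le ι _ _).trans_lt (max_lt h₁ h₂)

/-- Values of a Dirichlet character are `ι`-integral (roots of unity or `0`). [folklore] -/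
theorem v_symm_dirichletCharacter_le_one {L : ℕ} [NeZero L] (χ : DirichletCharacter ℂ L)
    (a : ZMod L) : Valued.v (ι.symm (χ a)) ≤ 1 := by
  by_cases ha : IsUnit a
  · have hn0 : 0 < orderOf χ := orderOf_pos χ
    have hpow : (χ a) ^ orderOf χ = 1 := by
      have h := MulChar.pow_apply_coe χ (orderOf χ) ha.unit
      rw [ha.unit_spec, pow_orderOf_eq_one, MulChar.one_apply ha] at h
      exact h.symm
    have h1 : Valued.v (ι.symm (χ a)) ^ orderOf χ = 1 := by
      rw [← Valuation.map_pow, ← map_pow, hpow, map_one, Valuation.map_one]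
    exact ((pow_eq_one_iff_of_nonneg zero_le hn0.ne').mp h1).le
  · rw [MulChar.map_nonunit χ ha, map_zero, Valuation.map_zero]
    exact zero_le_one

end Iota

/-! ### The theorem -/

section Main

variable {L : ℕ} [NeZero L] {k : ℤ}

set_option maxHeartbeats 1600000 in
/-- **Deligne–Serre 1974, 6.10–6.11 in the `ι`-language: a mod-`𝔪` Hecke eigenvector lifts to an
eigenform with congruent eigenvalues.**  Let `ι : ℚ̄_p ≃ ℂ`, `k ≥ 1`, `χ` a Dirichlet character
mod `L`, `P` a set of primes, `λ : P → ℂ`, and `G ∈ S_k(L, χ)` with `|ι⁻¹ a_n(G)|_p ≤ 1` for all `n`,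
`|ι⁻¹ a_{m₀}(G)|_p = 1` for some `m₀`, and `|ι⁻¹(a_n(T_q G) - λ_q a_n(G))|_p < 1` for all `q ∈ P`
and all `n` (`T_q` the Hecke operator of level `Γ₁(L)`, i.e. `U_q` when `q ∣ L`).  Then there are a
non-zero `g ∈ S_k(L, χ)` and `α : P → ℂ` with `T_q g = α_q g`, `|ι⁻¹ α_q|_p ≤ 1` and
`|ι⁻¹ α_q - ι⁻¹ λ_q|_p < 1` for every `q ∈ P`.  (Deligne–Serre's Lemme 6.11 applied to the `T_q`
acting on the forms of type `(k, χ)` with coefficients in the discrete valuation ring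
`𝒪_E ⊆ E ⊆ ℚ̄_p`, `E/ℚ_p` finite containing the coordinates of `G` in an integral basis; the output
congruences, a priori in an abstract discrete valuation ring over `𝒪_E`, are read in `ℚ̄_p` by the
uniqueness of the extension of the valuation of the complete field `E`.)
[cite: DeligneSerreASENS1974, 6.10 and Lemme 6.11; BillereyMenares2018, §3.2] -/
theorem exists_eigenform_of_modP_eigenvector (ι : PadicAlgCl p ≃+* ℂ) (hk : 1 ≤ k)
    (χ : DirichletCharacter ℂ L) (P : Set ℕ) (hP : ∀ q ∈ P, q.Prime) (lam : ℕ → ℂ)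
    {G : CuspForm (Gamma1 L) k} (hG : G ∈ nebentypusSubspace L k χ)
    (hGint : ∀ n, Valued.v (ι.symm (cuspCoeff G n)) ≤ 1)
    (m₀ : ℕ) (hm₀ : Valued.v (ι.symm (cuspCoeff G m₀)) = 1)
    (heig : ∀ (q : ℕ) (hq : q ∈ P) (n : ℕ),
      Valued.v (ι.symm (cuspCoeff
        (haveI : NeZero q := ⟨(hP q hq).ne_zero⟩; heckeT (Gamma1 L) k q G) n -
          lam q * cuspCoeff G n)) < 1) :
    ∃ (g : CuspForm (Gamma1 L) k) (α : ℕ → ℂ), g ≠ 0 ∧ g ∈ nebentypusSubspace L k χ ∧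
      ∀ (q : ℕ) (hq : q ∈ P),
        (haveI : NeZero q := ⟨(hP q hq).ne_zero⟩; heckeT (Gamma1 L) k q g) = α q • g ∧
        Valued.v (ι.symm (α q)) ≤ 1 ∧ Valued.v (ι.symm (α q) - ι.symm (lam q)) < 1 := by
  classical
  have hp : p.Prime := Fact.out
  -- ### the normalised form `x = a_{m₀}(G)⁻¹ G`
  set u : ℂ := cuspCoeff G m₀ with hu_def
  have hu0 : u ≠ 0 := by
    intro h
    rw [h, map_zero, Valuation.map_zero] at hm₀
    exact zero_ne_one hm₀
  have huinv : Valued.v (ι.symm u⁻¹) = 1 := by rw [map_inv₀, Valuation.map_inv, hm₀, inv_one]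
  let V : Type := CuspForm (Gamma1 L) k
  let x : V := u⁻¹ • G
  have hxcoeff : ∀ n, cuspCoeff x n = u⁻¹ * cuspCoeff G n := fun n ↦ cuspCoeff_smul_gamma1 _ _ _
  have hxint : ∀ n, Valued.v (ι.symm (cuspCoeff x n)) ≤ 1 := fun n ↦ by
    rw [hxcoeff, map_mul, Valuation.map_mul, huinv, one_mul]
    exact hGint n
  have hx1 : cuspCoeff x m₀ = 1 := by rw [hxcoeff, ← hu_def, inv_mul_cancel₀ hu0]
  let W : Submodule ℂ V := nebentypusSubspace L k χ
  have hxW : x ∈ W := W.smul_mem _ hG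
  have hxeig : ∀ (q : ℕ) (hq : q ∈ P) (n : ℕ),
      Valued.v (ι.symm (cuspCoeff
        (haveI : NeZero q := ⟨(hP q hq).ne_zero⟩; heckeT (Gamma1 L) k q x) n -
          lam q * cuspCoeff x n)) < 1 := by
    intro q hq n
    haveI : NeZero q := ⟨(hP q hq).ne_zero⟩
    have h1 : cuspCoeff (heckeT (Gamma1 L) k q x) n - lam q * cuspCoeff x n =
        u⁻¹ * (cuspCoeff (heckeT (Gamma1 L) k q G) n - lam q * cuspCoeff G n) := by
      change cuspCoeff (heckeT (Gamma1 L) k q (u⁻¹ • G)) n - lam q * cuspCoeff (u⁻¹ • G) n = _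
      rw [map_smul, cuspCoeff_smul_gamma1, cuspCoeff_smul_gamma1]
      ring
    rw [h1, map_mul, Valuation.map_mul, huinv, one_mul]
    exact heig q hq n
  -- ### the field `E = ℚ_p(ι⁻¹ cᵢ, ι⁻¹ χ(d))` and its unit ball `𝒪`
  have hspan := DeligneSerre1974_span_integralLattice1_holds L k hk
  let B₀ := integralBasis L k hspan
  let c : Module.Free.ChooseBasisIndex ℤ (integralLattice1 L k) → ℂ := B₀.equivFun x
  have hxc : B₀.equivFun.symm c = x := B₀.equivFun.symm_apply_apply x
  have hcoeffsum : ∀ n, cuspCoeff x n = ∑ i, c i * cuspCoeff (B₀ i) n := fun n ↦ by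
    rw [← hxc]
    exact cuspCoeff_equivFun_symm hspan c n
  let S : Set (PadicAlgCl p) :=
    Set.range (fun i ↦ ι.symm (c i)) ∪ Set.range (fun d : ZMod L ↦ ι.symm (χ d))
  have hSfin : S.Finite := (Set.finite_range _).union (Set.finite_range _)
  let E : IntermediateField ℚ_[p] (PadicAlgCl p) := IntermediateField.adjoin ℚ_[p] S
  haveI : Finite S := hSfin.to_subtype
  haveI : FiniteDimensional ℚ_[p] E :=
    IntermediateField.finiteDimensional_adjoin fun y _ ↦ Algebra.IsIntegral.isIntegral y
  have hcE : ∀ i, ι.symm (c i) ∈ E := fun i ↦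
    IntermediateField.subset_adjoin _ _ (Or.inl ⟨i, rfl⟩)
  have hχE : ∀ d : ZMod L, ι.symm (χ d) ∈ E := fun d ↦
    IntermediateField.subset_adjoin _ _ (Or.inr ⟨d, rfl⟩)
  have hcoeffE : ∀ n, ι.symm (cuspCoeff x n) ∈ E := by
    intro n
    rw [hcoeffsum, map_sum]
    refine sum_mem fun i _ ↦ ?_
    obtain ⟨z, hz⟩ := exists_int_cuspCoeff_integralBasis hspan i n
    rw [map_mul, ← hz, map_intCast]
    exact mul_mem (hcE i) (intCast_mem E z)
  -- the discrete valuation ring `𝒪 = 𝒪_E`, mapped into `ℂ` by `ι`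
  let 𝒪 : Type := (Valued.v.comap (algebraMap E (PadicAlgCl p))).valuationSubring
  haveI : IsDiscreteValuationRing 𝒪 := PadicAlgCl.isDiscreteValuationRing_unitBall E
  let algO : 𝒪 →+* ℂ := (ι : PadicAlgCl p ≃+* ℂ).toRingHom.comp
    ((algebraMap E (PadicAlgCl p)).comp
      (Valued.v.comap (algebraMap E (PadicAlgCl p))).valuationSubring.subtype)
  letI algInst : Algebra 𝒪 ℂ := algO.toAlgebra
  have halg : ∀ s : 𝒪, algebraMap 𝒪 ℂ s = ι (((s : E) : PadicAlgCl p)) := fun _ ↦ rfl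
  have halg' : ∀ s : 𝒪, ι.symm (algebraMap 𝒪 ℂ s) = ((s : E) : PadicAlgCl p) := fun s ↦ by
    rw [halg, RingEquiv.symm_apply_apply]
  have hinj : Function.Injective (algebraMap 𝒪 ℂ) := by
    intro s t h
    rw [halg, halg] at h
    exact Subtype.ext (Subtype.ext (ι.injective h))
  -- membership in the range / image of `𝔪` through `ι`
  have hrange : ∀ z : ℂ, ι.symm z ∈ E → Valued.v (ι.symm z) ≤ 1 →
      z ∈ (algebraMap 𝒪 ℂ).range := by
    intro z hzE hzv
    have hmem : (⟨ι.symm z, hzE⟩ : E) ∈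
        (Valued.v.comap (algebraMap E (PadicAlgCl p))).valuationSubring := by
      rw [PadicAlgCl.mem_unitBall_iff]
      exact (PadicAlgCl.valuation_le_one_iff _).mp hzv
    refine ⟨⟨_, hmem⟩, ?_⟩
    rw [halg]
    exact ι.apply_symm_apply z
  have hrange_E : ∀ z : ℂ, z ∈ (algebraMap 𝒪 ℂ).range → ι.symm z ∈ E := by
    rintro _ ⟨s, rfl⟩
    rw [halg']
    exact SetLike.coe_mem _
  have hrange_v : ∀ z : ℂ, z ∈ (algebraMap 𝒪 ℂ).range → Valued.v (ι.symm z) ≤ 1 := by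
    rintro _ ⟨s, rfl⟩
    rw [halg', PadicAlgCl.valuation_le_one_iff]
    exact (PadicAlgCl.mem_unitBall_iff E _).mp s.2
  have hmaxI : ∀ z : ℂ, ι.symm z ∈ E → Valued.v (ι.symm z) < 1 →
      z ∈ algebraMap 𝒪 ℂ '' (maximalIdeal 𝒪) := by
    intro z hzE hzv
    obtain ⟨s, hs⟩ := hrange z hzE hzv.le
    refine ⟨s, ?_, hs⟩
    rw [SetLike.mem_coe, PadicAlgCl.mem_maximalIdeal_unitBall_iff, ← PadicAlgCl.v_lt_one_iff,
      ← halg', hs]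
    exact hzv
  have hmax_v : ∀ s : 𝒪, s ∈ maximalIdeal 𝒪 → Valued.v (ι.symm (algebraMap 𝒪 ℂ s)) < 1 := by
    intro s hs
    rw [halg', PadicAlgCl.v_lt_one_iff]
    exact (PadicAlgCl.mem_maximalIdeal_unitBall_iff E s).mp hs
  have hp𝒪 : ((p : ℕ) : 𝒪) ∈ maximalIdeal 𝒪 := PadicAlgCl.natCast_mem_maximalIdeal_unitBall E
  -- ### the setting of `exists_eigenvector_lift`
  letI mod𝒪 : Module 𝒪 V := Module.compHom V (algebraMap 𝒪 ℂ)
  haveI : IsScalarTower 𝒪 ℂ V := ⟨fun r z w ↦ mul_smul (algebraMap 𝒪 ℂ r) z w⟩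
  let cf : ℕ → (V →ₗ[ℂ] ℂ) := fun m ↦ cuspCoeffₗ (HeckeTGamma1.one_mem_strictPeriods_Gamma1 L) m
  have hcf : ∀ (m : ℕ) (w : V), cf m w = cuspCoeff w m := fun _ _ ↦ rfl
  -- Sturm bound
  let B : ℕ := (((k * Nat.card (𝒮ℒ ⧸ (Gamma1 L : Subgroup (GL (Fin 2) ℝ)).subgroupOf 𝒮ℒ)).toNat
    / 12 : ℕ)) + 2
  have hc : ∀ w ∈ W, (∀ m < B, cf m w = 0) → w = 0 := fun w _ hw ↦
    cuspForm_eq_zero_of_qExpansion_coeff_eq_zero (HeckeTGamma1.one_mem_strictPeriods_Gamma1 L)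
      w (m := B) (fun i hi ↦ hw i hi) (by simp only [B]; omega)
  -- the operators `T_q`, `q ∈ P`
  let P' : Type := {q : ℕ // q ∈ P}
  let Tq : P' → (V →ₗ[ℂ] V) := fun q ↦
    haveI : NeZero q.1 := ⟨(hP q.1 q.2).ne_zero⟩; heckeT (Gamma1 L) k q.1
  let 𝒯 : Set (V →ₗ[ℂ] V) := Set.range Tq
  have hcomm : ∀ S₁ ∈ 𝒯, ∀ T ∈ 𝒯, Commute S₁ T := by
    rintro _ ⟨q₁, rfl⟩ _ ⟨q₂, rfl⟩
    haveI : NeZero q₁.1 := ⟨(hP q₁.1 q₁.2).ne_zero⟩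
    haveI : NeZero q₂.1 := ⟨(hP q₂.1 q₂.2).ne_zero⟩
    exact heckeT_comm_holds L k q₁.1 q₂.1
  have hWmem : ∀ w : V, w ∈ W ↔ ∀ d : (ZMod L)ˣ, diamondOp L k (d : ZMod L) w = χ d • w :=
    fun w ↦ mem_nebentypusSubspace_iff_diamondOp
  have hW : ∀ T ∈ 𝒯, ∀ w ∈ W, T w ∈ W := by
    rintro _ ⟨q, rfl⟩ w hw
    haveI : NeZero q.1 := ⟨(hP q.1 q.2).ne_zero⟩
    rw [hWmem] at hw ⊢
    intro d
    change diamondOp L k d (heckeT (Gamma1 L) k q.1 w) = χ d • heckeT (Gamma1 L) k q.1 w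
    rw [← Module.End.mul_apply, ← heckeT_diamondOp_comm_holds L k q.1 (d : ZMod L),
      Module.End.mul_apply, hw d, map_smul]
  -- diamonds act on `W` by `χ`, also at non-units (where both sides need not be compared)
  have hdiag : ∀ w ∈ W, ∀ (q : ℕ), q.Prime → ¬ q ∣ L →
      diamondOp L k (q : ZMod L) w = χ (q : ZMod L) • w := by
    intro w hw q hq hqL
    obtain ⟨d, hd⟩ := (ZMod.isUnit_prime_iff_not_dvd hq).mpr hqL
    rw [← hd]
    exact (hWmem w).mp hw d
  -- integrality is preserved by the `T_q`
  have hkpow : ∀ q : ℕ, ((q : ℂ)) ^ (k - 1) ∈ (algebraMap 𝒪 ℂ).range := by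
    intro q
    refine hrange _ ?_ ?_
    · rw [map_zpow₀, map_natCast]
      exact zpow_mem (natCast_mem E q) _
    · rw [map_zpow₀, map_natCast, show k - 1 = (((k - 1).toNat : ℕ) : ℤ) by omega, zpow_natCast,
        Valuation.map_pow]
      refine pow_le_one₀ zero_le ?_
      rw [PadicAlgCl.valuation_le_one_iff, ← map_natCast (algebraMap ℚ_[p] (PadicAlgCl p)),
        PadicAlgCl.norm_extends]
      exact_mod_cast Padic.norm_int_le_one (q : ℤ)
  have hχrange : ∀ d : ZMod L, (χ d : ℂ) ∈ (algebraMap 𝒪 ℂ).range := fun d ↦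
    hrange _ (hχE d) (v_symm_dirichletCharacter_le_one ι χ d)
  have hintT : ∀ T ∈ 𝒯, ∀ w ∈ W, (∀ m, cf m w ∈ (algebraMap 𝒪 ℂ).range) →
      ∀ m, cf m (T w) ∈ (algebraMap 𝒪 ℂ).range := by
    rintro _ ⟨q, rfl⟩ w hw hwint m
    obtain ⟨hq⟩ : Nonempty (q.1.Prime) := ⟨hP q.1 q.2⟩
    haveI : NeZero q.1 := ⟨hq.ne_zero⟩
    simp only [hcf] at hwint ⊢
    change cuspCoeff (heckeT (Gamma1 L) k q.1 w) m ∈ _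
    rw [cuspCoeff_heckeT_gamma1 w q.1 hq m]
    refine Subring.add_mem _ (hwint _) ?_
    by_cases hqL : q.1 ∣ L
    · rw [if_pos hqL]
      exact Subring.zero_mem _
    · rw [if_neg hqL, hdiag w hw q.1 hq hqL]
      refine Subring.mul_mem _ (hkpow q.1) ?_
      by_cases hqm : q.1 ∣ m
      · rw [if_pos hqm, cuspCoeff_smul_gamma1]
        exact Subring.mul_mem _ (hχrange _) (hwint _)
      · rw [if_neg hqm]
        exact Subring.zero_mem _
  have hx : ∀ m, cf m x ∈ (algebraMap 𝒪 ℂ).range := fun m ↦ by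
    rw [hcf]
    exact hrange _ (hcoeffE m) (hxint m)
  -- ### the mod-`𝔪` eigenvalues `a_T = a_{m₀}(T x)` and the congruence
  let a : (V →ₗ[ℂ] V) → 𝒪 := fun T ↦
    if h : T ∈ 𝒯 then (RingHom.mem_range.mp (hintT T h x hxW hx m₀)).choose else 0
  have ha : ∀ T (h : T ∈ 𝒯), algebraMap 𝒪 ℂ (a T) = cf m₀ (T x) := by
    intro T h
    simp only [a, dif_pos h]
    exact (RingHom.mem_range.mp (hintT T h x hxW hx m₀)).choose_spec
  -- `a_{m₀}(T_q x) ≡ λ_q`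
  have halam : ∀ q : P', Valued.v (ι.symm (cf m₀ (Tq q x) - lam q.1)) < 1 := by
    intro q
    have h := hxeig q.1 q.2 m₀
    rw [hx1, mul_one] at h
    exact h
  have hcongr : ∀ T ∈ 𝒯, ∀ m,
      cf m (T x) - algebraMap 𝒪 ℂ (a T) * cf m x ∈ algebraMap 𝒪 ℂ '' (maximalIdeal 𝒪) := by
    intro T hT m
    rw [ha T hT]
    obtain ⟨q, rfl⟩ := hT
    haveI : NeZero q.1 := ⟨(hP q.1 q.2).ne_zero⟩
    refine hmaxI _ ?_ ?_
    · rw [map_sub, map_mul]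
      exact sub_mem (hrange_E _ (hintT _ ⟨q, rfl⟩ x hxW hx m))
        (mul_mem (hrange_E _ (hintT _ ⟨q, rfl⟩ x hxW hx m₀)) (hcoeffE m))
    · -- `a_m(Tx) - a_{m₀}(Tx) a_m(x) = (a_m(Tx) - λ a_m(x)) - (a_{m₀}(Tx) - λ) a_m(x)`
      have h1 := hxeig q.1 q.2 m
      have h2 := halam q
      have hxm := hxint m
      have heq : cf m (Tq q x) - cf m₀ (Tq q x) * cf m x =
          (cf m (Tq q x) - lam q.1 * cf m x) - (cf m₀ (Tq q x) - lam q.1) * cf m x := by ring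
      rw [heq]
      have h3 := v_symm_add_le ι (cf m (Tq q x) - lam q.1 * cf m x)
        (-((cf m₀ (Tq q x) - lam q.1) * cf m x))
      rw [map_neg, Valuation.map_neg, ← sub_eq_add_neg] at h3
      refine h3.trans_lt (max_lt h1 ?_)
      rw [map_mul, Valuation.map_mul]
      calc Valued.v (ι.symm (cf m₀ (Tq q x) - lam q.1)) * Valued.v (ι.symm (cf m x))
          ≤ Valued.v (ι.symm (cf m₀ (Tq q x) - lam q.1)) * 1 :=
            mul_le_mul_right hxm _
        _ < 1 := by rw [mul_one]; exact h2
  -- ### 6.10–6.11: the lift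
  obtain ⟨K', _, _, _, _, _, 𝒪', _, _, _, _, _, _, _, e, hcomap, he, a', g, hg0, hgW, heig', hcong'⟩ :=
    Literature.RingTheory.DiscreteValuationRing.DeligneSerre1974.exists_eigenvector_lift hinj W cf B
      hc 𝒯 hcomm hW hintT x hxW hx m₀ (by rw [hcf]; exact hx1) a hcongr
  -- ### the `E`-algebra structure of `K'` and the `E`-embedding `φ = ι⁻¹ ∘ e`
  set F := FractionRing 𝒪 with hFdef
  let φE : E ≃ₐ[𝒪] F := (FractionRing.algEquiv 𝒪 E).symm
  letI algEK' : Algebra E K' := ((algebraMap F K').comp φE.toRingEquiv.toRingHom).toAlgebra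
  have halgEK' : ∀ t : E, algebraMap E K' t = algebraMap F K' (φE t) := fun _ ↦ rfl
  haveI : IsScalarTower 𝒪 E K' := IsScalarTower.of_algebraMap_eq fun s ↦ by
    rw [halgEK', show (algebraMap 𝒪 E s : E) = algebraMap 𝒪 E s from rfl, φE.commutes,
      ← IsScalarTower.algebraMap_apply]
  haveI : FiniteDimensional E K' := by
    obtain ⟨T₀, hT₀⟩ := Module.finite_def.mp (inferInstance : Module.Finite F K')
    refine Module.finite_def.mpr ⟨T₀, ?_⟩
    apply top_unique
    intro y _
    have hy : y ∈ Submodule.span F (T₀ : Set K') := hT₀ ▸ Submodule.mem_top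
    refine Submodule.span_induction (fun z hz ↦ Submodule.subset_span hz) (Submodule.zero_mem _)
      (fun _ _ _ _ h₁ h₂ ↦ Submodule.add_mem _ h₁ h₂) (fun f z _ hz ↦ ?_) hy
    have : f • z = (φE.symm f) • z := by
      rw [Algebra.smul_def, Algebra.smul_def, halgEK', AlgEquiv.apply_symm_apply]
    rw [this]
    exact Submodule.smul_mem _ _ hz
  let ψ : K' →+* PadicAlgCl p := (ι.symm : ℂ ≃+* PadicAlgCl p).toRingHom.comp e
  have hψ : ∀ z : K', ψ z = ι.symm (e z) := fun _ ↦ rfl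
  have hψE : ∀ t : E, ψ (algebraMap E K' t) = (t : PadicAlgCl p) := by
    have hext : ψ.comp (algebraMap E K') = algebraMap E (PadicAlgCl p) := by
      refine IsLocalization.ringHom_ext (nonZeroDivisors 𝒪) (RingHom.ext fun s ↦ ?_)
      simp only [RingHom.comp_apply]
      rw [← IsScalarTower.algebraMap_apply 𝒪 E K', hψ, he s, halg']
      rfl
    intro t
    exact congrArg (fun h : E →+* PadicAlgCl p ↦ h t) hext
  let φ : K' →ₐ[E] PadicAlgCl p := { ψ with commutes' := hψE }
  have hφ : ∀ z : K', φ z = ι.symm (e z) := fun _ ↦ rfl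
  -- `p ∈ 𝔪'`
  have hp𝒪' : ((p : ℕ) : 𝒪') ∈ maximalIdeal 𝒪' := by
    rw [← map_natCast (algebraMap 𝒪 𝒪') p, ← Ideal.mem_comap, hcomap]
    exact hp𝒪
  -- ### transport of the congruences into `ℚ̄_p`
  have htrans : ∀ y : 𝒪', Valued.v (ι.symm (e (algebraMap 𝒪' K' y))) ≤ 1 ∧
      (y ∈ maximalIdeal 𝒪' → Valued.v (ι.symm (e (algebraMap 𝒪' K' y))) < 1) := by
    intro y
    have h := PadicAlgCl.norm_algebraMap_le_one_of_dvr E hp𝒪' φ y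
    rw [hφ] at h
    exact ⟨(PadicAlgCl.valuation_le_one_iff _).mpr h.1, fun hy ↦ (PadicAlgCl.v_lt_one_iff _).mpr (h.2 hy)⟩
  -- ### conclusion
  refine ⟨g, fun q ↦ if hq : q ∈ P then e (algebraMap 𝒪' K' (a' (Tq ⟨q, hq⟩))) else 0, hg0, hgW,
    fun q hq ↦ ⟨?_, ?_, ?_⟩⟩
  · have hT : Tq ⟨q, hq⟩ ∈ 𝒯 := ⟨_, rfl⟩
    have h1 := heig' _ hT
    simp only [dif_pos hq]
    exact h1
  · simp only [dif_pos hq]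
    exact (htrans _).1
  · simp only [dif_pos hq]
    have hT : Tq ⟨q, hq⟩ ∈ 𝒯 := ⟨_, rfl⟩
    -- `e(a'_T) ≡ a_T (mod 𝔪')` read in `ℚ̄_p`, and `a_T ≡ λ_q`
    have h1 := (htrans _).2 (hcong' _ hT)
    rw [map_sub, map_sub, ← IsScalarTower.algebraMap_apply 𝒪 𝒪' K', he, ha _ hT] at h1
    rw [map_sub] at h1
    have h2 := halam ⟨q, hq⟩
    rw [← map_sub]
    exact v_symm_sub_lt_one_trans ι (by rw [map_sub]; exact h1) h2

end Main

end Literature.NumberTheory.EllipticCurves.ModularForms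

end
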